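import Mathlib
import Summits.Langlands.Langlands.Theses.ParityBlindBianchi

/-!
# Sketch (ideator 6, round 2) for crux `TwoAdicBianchiProModularityLevel` (stmt-Langlands-15110)

First lemma of the crux idea `two-adic-block-trichotomy`: the REGULARITY COMPUTATION at a place
`v ∣ 2` for the "primitive tetrahedral" local type.

At `p = 2` the obstruction space of the fixed-determinant (framed or unframed) deformation functor
of `σ̄_v : G_{ℚ₂} → GL₂(𝔽)` is `H²(G_{ℚ₂}, sl₂(σ̄_v)) ≅ H⁰(G_{ℚ₂}, pgl₂(σ̄_v))^∨` (local Tate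
duality; the mod-2 cyclotomic character is trivial and `sl₂^∨ ≅ pgl₂ := gl₂ / scalars`, which at
`p = 2` is NOT `sl₂`).  Hence the local ring is formally smooth iff `pgl₂(σ̄_v)` has no invariants
under the decomposition group, i.e. iff every matrix `X` whose conjugates by the local image differ
from `X` by scalars is itself scalar.  The toy `toys/pgl2_invariants.py` tabulates
`h⁰(pgl₂)` for every solvable subgroup type of `SL₂(𝔽₄) ≅ A₅` realisable as a local image over
`ℚ₂` (`1:3, C₂:2, V₄:1, C₃:1, C₅:1, S₃:1, A₄:0`); the theorem below is the kernel-checkable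
content of the entry `A₄ : 0`: the Borel subgroup `B(𝔽₄) = {(a b; 0 a⁻¹)} ≅ A₄` of `SL₂(𝔽₄)`,
generated by `u₁ = (1 1; 0 1)`, `u_ω = (1 ω; 0 1)`, `t = (ω 0; 0 ω⁻¹)` with `ω² + ω + 1 = 0`,
has NO non-scalar projective invariants on `M₂`.  It is stated over an arbitrary field of
characteristic `2` containing a primitive cube root of unity `ω` (so it applies to `𝔽₄ ⊆ 𝔽̄₂`),
with "conjugation invariance modulo scalars" written inverse-free as `g X = X g + c g`.

Consequence used by the card: for an icosahedral `σ` over a `2`-split imaginary quadratic `K` whose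
decomposition group at a place `v ∣ 2` has projective image `A₄` (the primitive, `2`-adic-only local
type of Weil's *Exercices dyadiques*), the unrestricted fixed-determinant framed deformation ring
`R_v^{□,ψ}` is a power series ring over `𝒪` in `6` variables, so Gee–Newton's miracle-flatness road
([GeeNewton2020, Lemma 49, Prop. "big R = 𝕋", Rem. 53]) is open at such `v` — contrary to the
round-1 consensus "no framed local ring at `v ∣ 2` is regular" (which checked `S₃` only).
-/

namespace Summit.Langlands.Langlands.Cruxes.TwoAdicBianchiProModularityLevel.Ideator6

open Matrix

/-- **No projective invariants of the `𝔽₄`-Borel on `M₂` (`h⁰(B(𝔽₄), pgl₂) = 0`).**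
Over a field `F` of characteristic `2` with `ω² + ω + 1 = 0`: if a `2 × 2` matrix `X` satisfies
`g X = X g + c_g • g` for the three generators `g ∈ {u₁, u_ω, t}` of the Borel subgroup of
`SL₂(𝔽₂(ω))` (i.e. `X` is invariant modulo scalars under conjugation by `B ≅ A₄`), then `X` is
scalar.  This is the vanishing `H⁰(G_{ℚ₂}, pgl₂(σ̄_v)) = 0`, equivalently
`H²(G_{ℚ₂}, sl₂(σ̄_v)) = 0`, for a residual local image of type `A₄` at `p = 2`. [folklore] -/
theorem borelF4_projInvariants_scalar {F : Type*} [Field F] [CharP F 2] (ω : F)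
    (hω : ω ^ 2 + ω + 1 = 0) (X : Matrix (Fin 2) (Fin 2) F)
    (h₁ : ∃ c : F, !![(1 : F), 1; 0, 1] * X = X * !![(1 : F), 1; 0, 1] + c • !![(1 : F), 1; 0, 1])
    (h₂ : ∃ c : F, !![(1 : F), ω; 0, 1] * X = X * !![(1 : F), ω; 0, 1] + c • !![(1 : F), ω; 0, 1])
    (h₃ : ∃ c : F, !![ω, 0; 0, ω + 1] * X = X * !![ω, 0; 0, ω + 1] + c • !![ω, 0; 0, ω + 1]) :
    ∃ c : F, X = c • (1 : Matrix (Fin 2) (Fin 2) F) := by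
  have h2 : (2 : F) = 0 := CharTwo.two_eq_zero
  -- ω ≠ 0 and ω + 1 ≠ 0
  have hω0 : ω ≠ 0 := by
    rintro rfl
    simp at hω
  have hω1 : ω + 1 ≠ 0 := by
    intro h
    have : ω = 1 := by
      have : ω = -1 := eq_neg_of_add_eq_zero_left h
      rw [this, CharTwo.neg_eq]
    rw [this] at hω
    norm_num at hω
    -- hω : (3 : F) = 0, but 3 = 1 in characteristic 2
    have h3 : (3 : F) = 1 := by
      have : (3 : F) = 2 + 1 := by norm_num
      rw [this, h2, zero_add]
    rw [h3] at hω
    exact one_ne_zero hω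
  obtain ⟨c₁, e₁⟩ := h₁
  obtain ⟨c₂, e₂⟩ := h₂
  obtain ⟨c₃, e₃⟩ := h₃
  -- name the entries of X
  set x := X 0 0 with hx
  set y := X 0 1 with hy
  set z := X 1 0 with hz
  set w := X 1 1 with hw
  have hX : X = !![x, y; z, w] := by
    rw [hx, hy, hz, hw]; exact Matrix.eta_fin_two X
  rw [hX] at e₁ e₂ e₃
  simp only [Matrix.mul_fin_two, Matrix.smul_of, Matrix.smul_cons, smul_eq_mul,
    Matrix.smul_empty, Matrix.of_add_of, Matrix.cons_add_cons, Matrix.empty_add_empty] at e₁ e₂ e₃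
  -- extract the entrywise equations we need
  have a00 := congrFun (congrFun (Matrix.of.injective e₁) 0) 0
  have a01 := congrFun (congrFun (Matrix.of.injective e₁) 0) 1
  have b00 := congrFun (congrFun (Matrix.of.injective e₂) 0) 0
  have b01 := congrFun (congrFun (Matrix.of.injective e₂) 0) 1
  have d00 := congrFun (congrFun (Matrix.of.injective e₃) 0) 0
  have d01 := congrFun (congrFun (Matrix.of.injective e₃) 0) 1
  simp only [Matrix.cons_val', Matrix.cons_val_zero, Matrix.cons_val_one,
    Matrix.empty_val', Matrix.cons_val_fin_one] at a00 a01 b00 b01 d00 d01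
  -- a00 : 1*x + 1*z = x*1 + y*0 + c₁*1      ⟹ z = c₁
  -- a01 : 1*y + 1*w = x*1 + y*1 + c₁*1      ⟹ w = x + c₁ = x + z
  -- b00 : 1*x + ω*z = x*1 + y*0 + c₂*1      ⟹ c₂ = ω z
  -- b01 : 1*y + ω*w = x*ω + y*1 + c₂*ω      ⟹ ω w = ω x + ω² z
  -- d00 : ω*x + 0*z = x*ω + y*0 + c₃*ω      ⟹ c₃ ω = 0
  -- d01 : ω*y + 0*w = x*0 + y*(ω+1) + c₃*0  ⟹ y = 0
  have hz0 : z = 0 := by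
    -- from a00, a01, b00, b01: (1 + ω) * z = 0... more precisely ω*(x+z) = ω*x + ω^2*z
    have hwxz : w = x + z := by linear_combination a01 - a00
    have key : ω * (ω + 1) * z = 0 := by
      linear_combination b01 - ω * hwxz - ω * b00 + ω ^ 2 * z * h2
    rcases mul_eq_zero.mp key with h | h
    · rcases mul_eq_zero.mp h with h' | h'
      · exact absurd h' hω0
      · exact absurd h' hω1
    · exact h
  have hwx : w = x := by
    have : w = x + z := by linear_combination a01 - a00
    rw [this, hz0, add_zero]
  have hy0 : y = 0 := by
    linear_combination d01 + y * h2
  refine ⟨x, ?_⟩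
  rw [hX, hy0, hz0, hwx]
  ext i j
  fin_cases i <;> fin_cases j <;> simp

/-- The crux decl this idea serves (documentation pointer; nothing is restated). -/
example : Prop := Summit.Langlands.Langlands.Theses.ParityBlindBianchi.TwoAdicBianchiProModularityLevel

end Summit.Langlands.Langlands.Cruxes.TwoAdicBianchiProModularityLevel.Ideator6
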